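import Mathlib

/-!
# `WeightedInvariant.LocalWeightedDrop`, line `cone-game-restriction-rank`: singular slice

Route `ResolutionOfSingularities/WeightedInvariant`, crux `LocalWeightedDrop`
(stmt-ResolutionOfSingularities-8899), stub `stub_sliceSingular` of the lead's skeleton
`work/LocalWeightedDrop.lean`, PROVED here (statement verbatim from the ledger registration).

**Statement (SINGULAR SLICE).** A successor germ `g` lives in
`k[[s, y₁, …, yₙ]] = MvPowerSeries (Fin (n+1)) k` (`s = X 0` the exceptional variable,
`yᵢ = X i.succ`).  Its restriction to the exceptional divisor `s = 0` is the `n`-variable slice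
`g(0,·) := (β ↦ coeff (Finsupp.cons 0 β) g)` (a multivariate power series IS its coefficient
function, so this lambda is a series and `coeff β g(0,·) = coeff (cons 0 β) g` definitionally).
If `g` is singular at the origin (no constant term and no linear terms), then so is `g(0,·)`:
its constant coefficient and all its linear coefficients `coeff (single i 1) g(0,·)` vanish.

**Proof.** The constant coefficient of the slice is its coefficient at the exponent `0`, i.e.
`coeff (cons 0 0) g = coeff 0 g = constantCoeff g = 0` (`Finsupp.cons_zero_zero`).  The linear
coefficient at `yᵢ` of the slice is `coeff (cons 0 (single i 1)) g = coeff (single i.succ 1) g = 0`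
(`Finsupp.cons_zero_single_eq_single_succ`): the slice's low-order coefficients are among those
of `g`.
-/

set_option linter.dupNamespace false -- mandated namespace of this single-conjunct summit

namespace Summit.ResolutionOfSingularities.ResolutionOfSingularities.Theorems

/-- SINGULAR SLICE, stub `stub_sliceSingular` of the line `cone-game-restriction-rank` of crux
`LocalWeightedDrop` (stmt-ResolutionOfSingularities-8899).  For `g : k[[s, y₁, …, yₙ]]`
(`s = X 0`) with vanishing constant and linear coefficients, the `s⁰`-slice
`g(0,·) = (β ↦ coeff (cons 0 β) g) : k[[y₁, …, yₙ]]` also has vanishing constant and linear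
coefficients. -/
theorem stub_sliceSingular : ∀ (k : Type) [Field k] (n : ℕ) (g : MvPowerSeries (Fin (n + 1)) k),
    (MvPowerSeries.constantCoeff g = 0 ∧ ∀ j, MvPowerSeries.coeff (Finsupp.single j 1) g = 0) →
    (MvPowerSeries.constantCoeff
        (show MvPowerSeries (Fin n) k from fun β => MvPowerSeries.coeff (Finsupp.cons 0 β) g) = 0 ∧
      ∀ i : Fin n, MvPowerSeries.coeff (Finsupp.single i 1)
        (show MvPowerSeries (Fin n) k from fun β => MvPowerSeries.coeff (Finsupp.cons 0 β) g) = 0) := by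
  intro k _ n g hg
  refine ⟨?_, fun i => ?_⟩
  · -- the constant coefficient of the slice is `coeff (cons 0 0) g = coeff 0 g = constantCoeff g`
    rw [← MvPowerSeries.coeff_zero_eq_constantCoeff_apply]
    show MvPowerSeries.coeff (Finsupp.cons 0 (0 : Fin n →₀ ℕ)) g = 0
    rw [Finsupp.cons_zero_zero, MvPowerSeries.coeff_zero_eq_constantCoeff_apply]
    exact hg.1
  · -- the `yᵢ`-linear coefficient of the slice is `coeff (cons 0 (single i 1)) g = coeff (single i.succ 1) g`
    show MvPowerSeries.coeff (Finsupp.cons 0 (Finsupp.single i 1)) g = 0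
    rw [Finsupp.cons_zero_single_eq_single_succ]
    exact hg.2 i.succ

end Summit.ResolutionOfSingularities.ResolutionOfSingularities.Theorems
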